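import Summits.AtomisticToContinuum.Crystallization.Theorems.OverbindingBudgetAffinePlanarLayer

/-!
# Overbinding budget, affine far-core cell (31280 Z2): the planar lines are ELEMENTARY (`planarT`), geometric `m`-envelope
# (decomp-a2c lens-4, generation 66, Deliverable I part 1 of 2 = memo NODE-g66 §13, item (T1b) planar kernel, structural half)

Imports g66 H2 `…PlanarLayer` (`planarLine`, `layerSum_zero_zero_eq_planarLines`, `besselKReal_sub_half_eq_halfPoly`, `halfPoly`).
Restates nothing.  PROVED, 0 sorry, standard axioms (probe `TowerTreeG66I.lean`; pins `TowerTreeG66IPins.lean`; must-fail `TowerTreeG66IMustFail.lean`).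

* §I1 `halfPoly_anti` (antitone on `(0,∞)`); `planarT σ t M = (πM/t)^σ e^{−2πtM} halfPoly (σ−1) (2πtM)/M` (integer powers, `exp`,
  a rational function — NO Bessel, NO `rpow`), `planarT_zero_right`, `planarT_nonneg`; ★ `rpow_mul_besselKReal_eq` —
  `(πM/t)^{σ−½} K_{σ−½}(2πtM) = planarT σ t M/(2√π)`; `sq_rpow_sub_half` (`(t²)^{σ−½} = t^{2σ−1}`);
  ★ `planarT_succ_le` — the RATIO bound `planarT σ t (M+1) ≤ ((M+1)/M)^{σ−1} e^{−2πt₀} planarT σ t M` (`M ≥ 1`, `t ≥ t₀ > 0`).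
* §I2 `gamma_five_halves` (`Γ(5/2) = 3√π/4`), `gamma_eleven_halves` (`Γ(11/2) = 945√π/32`), `planar_main_const_three` (`= 3π/8`),
  `planar_main_const_six` (`= 63π/256`); ★★ `planarLine_eq_elem` — for `j ≠ 0`, `a, D > 0`, `σ ≥ 1`, `t_j = |j|√D/a`:
  `planarLine σ a b D S j = a^{−σ}((√πΓ(σ−½)/Γσ)(a/(|j|√D))^{2σ−1} + (1/Γσ) Σ_{m∈ℤ} cos(2π(jb/a)m) planarT σ t_j |m|)`.
Part 2 (`…PlanarBounds`) truncates the `m`-series two-sidedly and drops far lines from below.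
-/

noncomputable section

open MeasureTheory Set Module
open scoped Real InnerProductSpace

namespace Summit.AtomisticToContinuum.Crystallization.Theorems.OverbindingBudgetAffineFarSmoothSplit
open Literature.MathematicalPhysics.StatisticalMechanics Literature.Algebra.EuclideanLattices
  Literature.Analysis.FunctionSpaces

/-! ## §I1 `halfPoly` is antitone; the ELEMENTARY planar term `planarT` -/

section PlanarT

/-- `halfPoly m` is antitone on `(0, ∞)` (all its coefficients are positive). [this file] -/
theorem halfPoly_anti : ∀ (m : ℕ) {y y' : ℝ}, 0 < y → y ≤ y' → halfPoly m y' ≤ halfPoly m y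
  | 0, _, _, _, _ => by simp
  | 1, y, y', hy, h => by
    rw [halfPoly_one, halfPoly_one]
    have : 1 / y' ≤ 1 / y := one_div_le_one_div_of_le hy h
    linarith
  | (m + 2), y, y', hy, h => by
    rw [halfPoly_add_two, halfPoly_add_two]
    have hy' : 0 < y' := hy.trans_le h
    have h0 := halfPoly_anti m hy h
    have h1 := halfPoly_anti (m + 1) hy h
    have hp1 : 0 ≤ halfPoly (m + 1) y' := (halfPoly_pos (m + 1) hy').le
    have hc : (2 * (m : ℝ) + 3) / y' ≤ (2 * (m : ℝ) + 3) / y :=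
      div_le_div_of_nonneg_left (by positivity) hy h
    have : (2 * (m : ℝ) + 3) / y' * halfPoly (m + 1) y' ≤ (2 * (m : ℝ) + 3) / y * halfPoly (m + 1) y :=
      mul_le_mul hc h1 hp1 (by positivity)
    linarith

/-- The ELEMENTARY planar term (`t = √c > 0`, `M = |m|`):
`planarT σ t M = (πM/t)^σ · e^{−2πtM} · halfPoly (σ−1) (2πtM) / M` — so that
`(πM/t)^{σ−½} K_{σ−½}(2πtM) = planarT σ t M / (2√π)` (`rpow_mul_besselKReal_eq`). Integer powers, `exp`, a rational function: no Bessel,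
no `rpow`. At `M = 0` it is `0` (Lean's `x/0 = 0`). [this file] -/
def planarT (σ : ℕ) (t M : ℝ) : ℝ :=
  (π * M / t) ^ σ * Real.exp (-(2 * π * t * M)) * halfPoly (σ - 1) (2 * π * t * M) / M

/-- `planarT_zero_right` (docstring added by the landing lane; see the module docstring). [formal bookkeeping] -/
@[simp] theorem planarT_zero_right (σ : ℕ) (t : ℝ) : planarT σ t 0 = 0 := by simp [planarT]

/-- `planarT_nonneg` (docstring added by the landing lane; see the module docstring). [formal bookkeeping] -/
theorem planarT_nonneg (σ : ℕ) {t M : ℝ} (ht : 0 < t) (hM : 0 ≤ M) : 0 ≤ planarT σ t M := by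
  rcases hM.eq_or_lt with rfl | hM
  · simp
  · unfold planarT
    have := halfPoly_pos (σ - 1) (show 0 < 2 * π * t * M by positivity)
    positivity

/-- ★ The half-integer Bessel factor of the planar lines IS `planarT / (2√π)`:
`(πM/t)^{σ−½} · K_{σ−½}(2πtM) = planarT σ t M / (2√π)` for `t, M > 0`, `σ ≥ 1`. [this file] -/
theorem rpow_mul_besselKReal_eq (σ : ℕ) (hσ : 1 ≤ σ) {t M : ℝ} (ht : 0 < t) (hM : 0 < M) :
    (π * M / t) ^ ((σ : ℝ) - 1 / 2) * besselKReal ((σ : ℝ) - 1 / 2) (2 * π * t * M) =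
      planarT σ t M / (2 * Real.sqrt π) := by
  have hy : 0 < 2 * π * t * M := by positivity
  have hx : 0 < π * M / t := by positivity
  rw [besselKReal_sub_half_eq_halfPoly σ hσ hy, Real.rpow_sub hx, Real.rpow_natCast, ← Real.sqrt_eq_rpow]
  have h1 : Real.sqrt (π / (2 * (2 * π * t * M))) * (2 * Real.sqrt π * M) = Real.sqrt (π * M / t) := by
    rw [← sq_eq_sq₀ (by positivity) (Real.sqrt_nonneg _), mul_pow, mul_pow, mul_pow,
      Real.sq_sqrt (by positivity), Real.sq_sqrt (by positivity), Real.sq_sqrt hx.le]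
    field_simp
  have hs : Real.sqrt (π * M / t) ≠ 0 := (Real.sqrt_pos.2 hx).ne'
  have hs' : Real.sqrt (π / (2 * (2 * π * t * M))) ≠ 0 := (Real.sqrt_pos.2 (by positivity)).ne'
  unfold planarT
  rw [← h1]
  field_simp

/-- `c^{σ−½} = t^{2σ−1}` for `c = t²`, `t > 0`. [this file] -/
theorem sq_rpow_sub_half (σ : ℕ) (hσ : 1 ≤ σ) {t : ℝ} (ht : 0 < t) :
    (t ^ 2) ^ ((σ : ℝ) - 1 / 2) = t ^ (2 * σ - 1) := by
  rw [show t ^ 2 = t ^ ((2 : ℕ) : ℝ) from (Real.rpow_natCast t 2).symm, ← Real.rpow_mul ht.le,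
    show ((2 : ℕ) : ℝ) * ((σ : ℝ) - 1 / 2) = ((2 * σ - 1 : ℕ) : ℝ) by
      rw [Nat.cast_sub (by omega)]; push_cast; ring,
    Real.rpow_natCast]

/-- The RATIO bound of consecutive planar terms: for `M ≥ 1`, `t ≥ t₀ > 0`, `σ ≥ 1`,
`planarT σ t (M+1) ≤ ((M+1)/M)^{σ−1} · e^{−2πt₀} · planarT σ t M` (`halfPoly` antitone, `e^{−2πt} ≤ e^{−2πt₀}`): the `m`-tail
of every line is dominated by a geometric series. [this file] -/
theorem planarT_succ_le (σ : ℕ) (hσ : 1 ≤ σ) {t t₀ M : ℝ} (ht₀ : 0 < t₀) (ht : t₀ ≤ t) (hM : 1 ≤ M) :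
    planarT σ t (M + 1) ≤ ((M + 1) / M) ^ (σ - 1) * Real.exp (-(2 * π * t₀)) * planarT σ t M := by
  have htp : 0 < t := ht₀.trans_le ht
  have hM0 : 0 < M := by linarith
  have hy : 0 < 2 * π * t * M := by positivity
  have hyy : 2 * π * t * M ≤ 2 * π * t * (M + 1) := by nlinarith [Real.pi_pos]
  have hhp : halfPoly (σ - 1) (2 * π * t * (M + 1)) ≤ halfPoly (σ - 1) (2 * π * t * M) := halfPoly_anti _ hy hyy
  have hhp0 : 0 < halfPoly (σ - 1) (2 * π * t * (M + 1)) := halfPoly_pos _ (by positivity)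
  have hexp : Real.exp (-(2 * π * t * (M + 1))) = Real.exp (-(2 * π * t)) * Real.exp (-(2 * π * t * M)) := by
    rw [← Real.exp_add]; congr 1; ring
  have hexp' : Real.exp (-(2 * π * t)) ≤ Real.exp (-(2 * π * t₀)) := by
    rw [Real.exp_le_exp]; nlinarith [Real.pi_pos]
  have hpow : (π * (M + 1) / t) ^ σ = ((M + 1) / M) ^ (σ - 1) * ((M + 1) / M) * (π * M / t) ^ σ := by
    obtain ⟨k, rfl⟩ : ∃ k, σ = k + 1 := ⟨σ - 1, by omega⟩
    rw [Nat.add_sub_cancel, ← pow_succ, ← mul_pow]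
    congr 1
    field_simp
  unfold planarT
  rw [hpow, hexp]
  have e1 : ((M + 1) / M) ^ (σ - 1) * ((M + 1) / M) * (π * M / t) ^ σ *
        (Real.exp (-(2 * π * t)) * Real.exp (-(2 * π * t * M))) * halfPoly (σ - 1) (2 * π * t * (M + 1)) / (M + 1) =
      ((M + 1) / M) ^ (σ - 1) * Real.exp (-(2 * π * t)) * halfPoly (σ - 1) (2 * π * t * (M + 1)) *
        ((π * M / t) ^ σ * Real.exp (-(2 * π * t * M)) / M) := by
    field_simp
  rw [e1]
  have e2 : ((M + 1) / M) ^ (σ - 1) * Real.exp (-(2 * π * t₀)) *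
        ((π * M / t) ^ σ * Real.exp (-(2 * π * t * M)) * halfPoly (σ - 1) (2 * π * t * M) / M) =
      ((M + 1) / M) ^ (σ - 1) * Real.exp (-(2 * π * t₀)) * halfPoly (σ - 1) (2 * π * t * M) *
        ((π * M / t) ^ σ * Real.exp (-(2 * π * t * M)) / M) := by ring
  rw [e2]
  have hA : 0 ≤ ((M + 1) / M) ^ (σ - 1) := by positivity
  have hB : 0 ≤ (π * M / t) ^ σ * Real.exp (-(2 * π * t * M)) / M := by positivity
  gcongr

end PlanarT

/-! ## §I2 Half-integer Γ values and the ELEMENTARY form of the planar lines -/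

section PlanarElem

/-- `Γ(5/2) = (3/4)√π`. [Mathlib `Real.Gamma_add_one`, `Real.Gamma_one_half_eq`] -/
theorem gamma_five_halves : Real.Gamma (5 / 2) = 3 / 4 * Real.sqrt π := by
  rw [show (5 / 2 : ℝ) = 3 / 2 + 1 by norm_num, Real.Gamma_add_one (by norm_num),
    show (3 / 2 : ℝ) = 1 / 2 + 1 by norm_num, Real.Gamma_add_one (by norm_num), Real.Gamma_one_half_eq]
  ring

/-- `Γ(11/2) = (945/32)√π`. -/
theorem gamma_eleven_halves : Real.Gamma (11 / 2) = 945 / 32 * Real.sqrt π := by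
  rw [show (11 / 2 : ℝ) = 9 / 2 + 1 by norm_num, Real.Gamma_add_one (by norm_num),
    show (9 / 2 : ℝ) = 7 / 2 + 1 by norm_num, Real.Gamma_add_one (by norm_num),
    show (7 / 2 : ℝ) = 5 / 2 + 1 by norm_num, Real.Gamma_add_one (by norm_num), gamma_five_halves]
  ring

/-- `√π·Γ(5/2)/Γ(3) = 3π/8` and `√π·Γ(11/2)/Γ(6) = 63π/256`: the MAIN-term constants of the planar lines at `σ = 3, 6`. -/
theorem planar_main_const_three : Real.sqrt π * Real.Gamma ((3 : ℕ) - 1 / 2 : ℝ) / Real.Gamma (3 : ℕ) = 3 * π / 8 := by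
  rw [show ((3 : ℕ) - 1 / 2 : ℝ) = 5 / 2 by norm_num, gamma_five_halves,
    show ((3 : ℕ) : ℝ) = 2 + 1 by norm_num, Real.Gamma_add_one (by norm_num), Real.Gamma_two]
  nlinarith [Real.sq_sqrt Real.pi_pos.le]

/-- `planar_main_const_six` (docstring added by the landing lane; see the module docstring). [formal bookkeeping] -/
theorem planar_main_const_six : Real.sqrt π * Real.Gamma ((6 : ℕ) - 1 / 2 : ℝ) / Real.Gamma (6 : ℕ) = 63 * π / 256 := by
  rw [show ((6 : ℕ) - 1 / 2 : ℝ) = 11 / 2 by norm_num, gamma_eleven_halves,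
    show ((6 : ℕ) : ℝ) = 5 + 1 by norm_num, Real.Gamma_add_one (by norm_num),
    show (5 : ℝ) = 4 + 1 by norm_num, Real.Gamma_add_one (by norm_num),
    show (4 : ℝ) = 3 + 1 by norm_num, Real.Gamma_add_one (by norm_num),
    show (3 : ℝ) = 2 + 1 by norm_num, Real.Gamma_add_one (by norm_num), Real.Gamma_two]
  nlinarith [Real.sq_sqrt Real.pi_pos.le]

/-- ★★ **The planar lines are ELEMENTARY.**  For `j ≠ 0`, `a > 0`, `D > 0`, `σ ≥ 1`, with `t_j = |j|√D/a`:
`planarLine σ a b D S j = a^{−σ}·( (√πΓ(σ−½)/Γσ)·(a/(|j|√D))^{2σ−1} + (1/Γσ)·Σ_{m∈ℤ} cos(2π(jb/a)m)·planarT σ t_j |m| )`,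
`planarT σ t M = (πM/t)^σ e^{−2πtM} halfPoly (σ−1) (2πtM)/M`: integer powers, `exp`, `cos`, one `√D`, rational functions — the per-box
planar kernel needs only `π`, `√`, `exp` and `cos` brackets (`√πΓ(σ−½)/Γσ = 3π/8`, `63π/256` at `σ = 3, 6`). [this file] -/
theorem planarLine_eq_elem (σ : ℕ) (hσ : 1 ≤ σ) {a b D : ℝ} (S : ℝ) (ha : 0 < a) (hD : 0 < D) {j : ℤ} (hj : j ≠ 0) :
    planarLine σ a b D S j = (a ^ σ)⁻¹ *
      (Real.sqrt π * Real.Gamma ((σ : ℝ) - 1 / 2) / Real.Gamma σ * (a / (|(j : ℝ)| * Real.sqrt D)) ^ (2 * σ - 1) +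
        1 / Real.Gamma σ * ∑' m : ℤ, Real.cos (2 * π * ((j : ℝ) * b / a) * m) *
          planarT σ (|(j : ℝ)| * Real.sqrt D / a) |(m : ℝ)|) := by
  have hj' : 0 < |(j : ℝ)| := abs_pos.2 (Int.cast_ne_zero.2 hj)
  have ht : 0 < |(j : ℝ)| * Real.sqrt D / a := by
    have := Real.sqrt_pos.2 hD; positivity
  have hsq : Real.sqrt ((j : ℝ) ^ 2 * D / a ^ 2) = |(j : ℝ)| * Real.sqrt D / a := by
    rw [Real.sqrt_div' _ (sq_nonneg a), Real.sqrt_mul (sq_nonneg _), Real.sqrt_sq_eq_abs, Real.sqrt_sq ha.le]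
  have hc : (j : ℝ) ^ 2 * D / a ^ 2 = (|(j : ℝ)| * Real.sqrt D / a) ^ 2 := by
    rw [div_pow, mul_pow, sq_abs, Real.sq_sqrt hD.le]
  unfold planarLine
  rw [if_neg hj, hsq, hc, sq_rpow_sub_half σ hσ ht]
  congr 1
  have hmain : Real.Gamma ((σ : ℝ) - 1 / 2) / (|(j : ℝ)| * Real.sqrt D / a) ^ (2 * σ - 1) =
      Real.Gamma ((σ : ℝ) - 1 / 2) * (a / (|(j : ℝ)| * Real.sqrt D)) ^ (2 * σ - 1) := by
    rw [div_eq_mul_inv, ← inv_pow, inv_div]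
  have hterm : ∀ m : ℤ, Real.cos (2 * π * ((j : ℝ) * b / a) * m) *
      ((π * |(m : ℝ)| / (|(j : ℝ)| * Real.sqrt D / a)) ^ ((σ : ℝ) - 1 / 2) *
        besselKReal ((σ : ℝ) - 1 / 2) (2 * π * (|(j : ℝ)| * Real.sqrt D / a) * |(m : ℝ)|)) =
      Real.cos (2 * π * ((j : ℝ) * b / a) * m) * (planarT σ (|(j : ℝ)| * Real.sqrt D / a) |(m : ℝ)| / (2 * Real.sqrt π)) := by
    intro m
    rcases eq_or_ne m 0 with rfl | hm
    · have hne : (σ : ℝ) - 1 / 2 ≠ 0 := by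
        have : (1 : ℝ) ≤ σ := by exact_mod_cast hσ
        linarith
      simp only [Int.cast_zero, abs_zero, mul_zero, zero_div, planarT_zero_right]
      rw [Real.zero_rpow hne, zero_mul, mul_zero]
    · rw [rpow_mul_besselKReal_eq σ hσ ht (abs_pos.2 (Int.cast_ne_zero.2 hm))]
  rw [hmain, tsum_congr hterm]
  have hsum : ∑' m : ℤ, Real.cos (2 * π * ((j : ℝ) * b / a) * m) *
        (planarT σ (|(j : ℝ)| * Real.sqrt D / a) |(m : ℝ)| / (2 * Real.sqrt π)) =
      (∑' m : ℤ, Real.cos (2 * π * ((j : ℝ) * b / a) * m) * planarT σ (|(j : ℝ)| * Real.sqrt D / a) |(m : ℝ)|) /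
        (2 * Real.sqrt π) := by
    rw [← tsum_div_const]
    refine tsum_congr fun m => ?_
    ring
  rw [hsum]
  have hπ : Real.sqrt π ≠ 0 := (Real.sqrt_pos.2 Real.pi_pos).ne'
  have hΓ : Real.Gamma σ ≠ 0 := by
    rw [show (σ : ℝ) = ((σ - 1 : ℕ) : ℝ) + 1 by rw [Nat.cast_sub hσ]; push_cast; ring, Real.Gamma_nat_eq_factorial]
    positivity
  field_simp

end PlanarElem

end Summit.AtomisticToContinuum.Crystallization.Theorems.OverbindingBudgetAffineFarSmoothSplit

end
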